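import Summits.QuantumFields.YangMills.Theorems.SwapVirialDeficitBlowUpGnomonicFibreHessianPackage
import Summits.QuantumFields.YangMills.Theorems.SwapVirialDeficitQuantitativeLaplaceGaussianFloor
import Summits.QuantumFields.YangMills.Theorems.SwapVirialDeficitBlowUpRingPaths
import HarnessLib

/-!
# Route `SwapVirialDeficit` (YangMills): a QUANTITATIVE FLOOR for the Morse–Bott main constant of the σ-glued sector `000` — the model half of stub S4b
# (`𝔐₀(L) ≥ K_L·¼·(20400L⁴)^{−α}`, hence `log 𝔐₀ ≥ −poly(L)`), from w2 g59's fibre sockets and the Gaussian floor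

LEAD ym-line-sfw-p2 g97 (cell ym-idea-1, free hands; `--supports stmt-QuantumFields-24197`).  Referee finding (F1) on fcl-p3 g47's skeleton ➍: the window arithmetic
must absorb two ABSOLUTE exponentially small terms into `b^{−θ}(2π/b)^α𝔐₀`, which needs a quantitative floor on the main constant
`𝔐₀ = K_L·Σ_{good ε}∫_cone∫_{ℝ²} 𝔪`, `𝔪(a,ε,p) = ρ(η₀(p))·(2π)^{−α}·∫_{V_L} e^{−½Q_{a,ε,p}}`, `Q_{a,ε,p}(y) = (d²/ds²)F̂(η₀(p) + s·gnoFibreEmb y)|₀`, `α = dim V_L/2 = 9L⁴ − 1`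
(g47's ⧗`SectorLaplaceDefs`: `mbConst`, `mbDensity`, `fibQ`; here the SAME expressions are written out, so the skeleton's `stub_mbConst_floor` is this file's §3 after `unfold`).

* §1 ★ `fibreFactor_floor` — at a hub `a` with `re a ≠ 0`, `im a ≠ 0`, good signs and ANY base point `p`: `(20400L⁴)^{−α} ≤ (2π)^{−α}∫e^{−½Q}` (and the integrand is
  integrable): upper form bound `|⟪A p y,y⟫| ≤ 20400L⁴‖y‖²` and coercivity at the flat base from w2 g59's ✓`gnoFibre_bulk_sockets` (w3's ✓`fibre_raySecond_coercive_gnomonic_flat`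
  inside), then ✓`normalised_gaussian_floor_of_le`;
* §2 `gnoDensity_gnoBase_ge` — `ρ(η₀(x₀,y₀)) = (1+x₀²)^{−2}(1+y₀²)^{−2} ≥ 1/16` on the unit base square;
* §3 ★★ `mainTerm_floor_of_integrable` — for the all-plus sign pattern, GIVEN integrability of `(a,p) ↦ 𝔪` on `cone × ℝ²` (stub S3, w2 g59):
  `¼·(20400L⁴)^{−α} ≤ ∫_cone∫_{ℝ²}𝔪` (cone-a.e. hub has `re ≠ 0`, `imI ≠ 0`: ✓`volume_re_eq_zero` and its `i`-rotated twin; Fubini; the unit square has area 4);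
  ★★ `mainConst_floor_of_integrable` — for any finite set of sign patterns containing the all-plus one and any `K ≥ 0`: `K·¼·(20400L⁴)^{−α} ≤ K·Σ∫∫𝔪`.

HONEST LABEL: an explicit lower bound (conditional on S3's integrability, as every positive statement about a Bochner-defined `𝔐₀` must be); the logarithmic
arithmetic `log(K_L·¼·(20400L⁴)^{−α}) ≥ −K·L⁵` is left to the window-arithmetic stub; ⟨24197⟩ ∕ ⟨24194⟩ OPEN; ⟨24196⟩ proved; own crux ⟨22884⟩ OPEN (blocked-on ⟨19935⟩);
the Yang–Mills mass gap is NOT proved; no summit is proved by a line.  THEOREMS ONLY (0 `def`, 0 `sorry`), standard axioms; local `ℍ` measurable-space instances as in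
the chart files.  References: [cite: Luscher1983, §2]; [cite: Breitung1994, Lemma 39 p. 55]; [folklore].
-/

set_option autoImplicit false
set_option synthInstance.maxSize 1024

noncomputable section

open MeasureTheory Quaternion Set Metric
open scoped BigOperators Quaternion ContDiff InnerProductSpace ENNReal
open Literature.MathematicalPhysics.QuantumFieldTheory hiding SU2
open Literature.MathematicalPhysics.QuantumLattice

attribute [local instance] Literature.Analysis.FluidPDE.Tao2016.quatMeasurableSpace
  Literature.Analysis.FluidPDE.Tao2016.quatBorelSpace
  Literature.MathematicalPhysics.QuantumLattice.secondCountableTopology_su2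

namespace Summit.QuantumFields.YangMills.Theorems.SwapVirialDeficit.BlowUpRing

open Summit.QuantumFields.YangMills.Theorems.FemtoTransferGap
open Summit.QuantumFields.YangMills.Theorems.FemtoTransferGap.TT
open Summit.QuantumFields.YangMills.Theorems.VirialFluxGap.RingDeficit
open Summit.QuantumFields.YangMills.Theorems.SwapVirialDeficit.SwapRing
open Summit.QuantumFields.YangMills.Theorems.SwapTwistDeficit.ToronLog (coneMeasure coneConst isProbabilityMeasure_coneMeasure)
open Summit.QuantumFields.YangMills.Theorems.SwapVirialDeficit.Gnomonic (normSq3 gnomonicWeight piWeight)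
open Summit.QuantumFields.YangMills.Theorems.QuantitativeLaplace (normalised_gaussian_floor_of_le gaussian_floor_of_le)

variable {L : ℕ} [NeZero L]

/-! ## §1 The fibre factor floor -/

/-- ★ **FIBRE FACTOR FLOOR.**  At a hub `a` with `re a ≠ 0` and `im a ≠ 0`, signs `ε_z = +`, followers `+`, and any base point `p = (x₀, y₀)`:
`y ↦ e^{−½Q(y)}` is integrable on `V_L` and `(20400·L⁴)^{−dim V_L/2} ≤ (2π)^{−dim V_L/2}·∫_{V_L} e^{−½Q}`, `Q(y) = (d²/ds²)F̂(η₀(p) + s·gnoFibreEmb y)|₀`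
(✓`gnoFibre_bulk_sockets`: `Q = ⟪A p y, y⟫`, `|Q| ≤ 20400L⁴‖y‖²`, `Q ≥ μ′‖y‖²` with `μ′ > 0`; ✓`normalised_gaussian_floor_of_le`). [cite: Luscher1983, §2] [cite: Breitung1994, Lemma 39 p. 55] -/
theorem fibreFactor_floor {a : ℍ} (hre : a.re ≠ 0) (him : a.im ≠ 0) (ε : GnoSign L) (hz : ε.2.1 = true) (hε : ε.2.2 = fun _ => true) (p : ℝ × ℝ) :
    Integrable (fun y : GnoFibre L => Real.exp (-(iteratedDeriv 2
        (fun s : ℝ => gnoDeficit (fun _ => false) (fun _ => 1) a ε (gnoBase p.1 p.2 + s • gnoFibreEmb y)) 0 / 2))) ∧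
    (20400 * (L : ℝ) ^ 4) ^ (-((Module.finrank ℝ (GnoFibre L) : ℝ) / 2)) ≤
      ((2 * Real.pi) ^ ((Module.finrank ℝ (GnoFibre L) : ℝ) / 2))⁻¹ *
        ∫ y : GnoFibre L, Real.exp (-(iteratedDeriv 2
          (fun s : ℝ => gnoDeficit (fun _ => false) (fun _ => 1) a ε (gnoBase p.1 p.2 + s • gnoFibreEmb y)) 0 / 2)) := by
  have ha : a ≠ 0 := fun h => hre (by rw [h]; rfl)
  obtain ⟨A, ρ, e, -, hAm, -, -, hray, hAbd, -, -, -, -, hcoer⟩ := gnoFibre_bulk_sockets (L := L) ha ε hz hε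
  have hL1 : (1 : ℝ) ≤ L := by exact_mod_cast NeZero.one_le
  have hL0 : (0 : ℝ) < L := by positivity
  have hΛ : (0 : ℝ) < 20400 * (L : ℝ) ^ 4 := by positivity
  -- the coercivity constant at this hub and base point
  have hna : 0 < ‖a‖ := norm_pos_iff.2 ha
  have hima : 0 < ‖a.im‖ := norm_pos_iff.2 him
  have hcx : 0 < 2 * (2 * (‖a‖⁻¹ * a.re) * (‖a‖⁻¹ * ‖a.im‖)) ^ 2 / ((2 + p.1 ^ 2) * (16200 * (L : ℝ) ^ 6)) := by
    have hne : 2 * (‖a‖⁻¹ * a.re) * (‖a‖⁻¹ * ‖a.im‖) ≠ 0 := by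
      refine mul_ne_zero (mul_ne_zero two_ne_zero (mul_ne_zero (inv_ne_zero hna.ne') hre)) ?_
      exact mul_ne_zero (inv_ne_zero hna.ne') hima.ne'
    have hsq : 0 < (2 * (‖a‖⁻¹ * a.re) * (‖a‖⁻¹ * ‖a.im‖)) ^ 2 := by rw [sq]; exact mul_self_pos.2 hne
    positivity
  have hcy : 0 < 2 * (‖a‖⁻¹ * ‖a.im‖) ^ 2 / ((2 + p.2 ^ 2) * (16200 * (L : ℝ) ^ 6)) := by
    have hne : ‖a‖⁻¹ * ‖a.im‖ ≠ 0 := mul_ne_zero (inv_ne_zero hna.ne') hima.ne'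
    have hsq : 0 < (‖a‖⁻¹ * ‖a.im‖) ^ 2 := by rw [sq]; exact mul_self_pos.2 hne
    positivity
  have hcz : (0 : ℝ) < 1 / (16200 * (L : ℝ) ^ 6) := by positivity
  have hcF : (0 : ℝ) < (2304 * (L : ℝ) ^ 6 * (Fintype.card (Fol L) : ℝ))⁻¹ / 2 := by
    have hcard : (0 : ℝ) < (Fintype.card (Fol L) : ℝ) := by
      rw [card_fol]
      have h1 : 1 ≤ L ^ 4 := Nat.one_le_pow _ _ (Nat.pos_of_ne_zero (NeZero.ne L))
      have : (3 : ℕ) ≤ 6 * L ^ 4 - 3 := by omega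
      exact_mod_cast lt_of_lt_of_le (by norm_num : (0 : ℕ) < 3) this
    positivity
  set μ' : ℝ := min (min (2 * (2 * (‖a‖⁻¹ * a.re) * (‖a‖⁻¹ * ‖a.im‖)) ^ 2 / ((2 + p.1 ^ 2) * (16200 * (L : ℝ) ^ 6)))
      (2 * (‖a‖⁻¹ * ‖a.im‖) ^ 2 / ((2 + p.2 ^ 2) * (16200 * (L : ℝ) ^ 6))))
    (min (1 / (16200 * (L : ℝ) ^ 6)) ((2304 * (L : ℝ) ^ 6 * (Fintype.card (Fol L) : ℝ))⁻¹ / 2)) with hμ'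
  have hμ0 : 0 < μ' := lt_min (lt_min hcx hcy) (lt_min hcz hcF)
  have hlo : ∀ y : GnoFibre L, μ' * ‖y‖ ^ 2 ≤ ⟪A p y, y⟫_ℝ := fun y =>
    hcoer p.1 p.2 μ' hμ0 ((min_le_left _ _).trans (min_le_left _ _)) ((min_le_left _ _).trans (min_le_right _ _))
      ((min_le_right _ _).trans (min_le_left _ _)) ((min_le_right _ _).trans (min_le_right _ _)) y
  have hhi : ∀ y : GnoFibre L, ⟪A p y, y⟫_ℝ ≤ 20400 * (L : ℝ) ^ 4 * ‖y‖ ^ 2 := fun y => (le_abs_self _).trans (hAbd p y)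
  have hQm : Measurable fun y : GnoFibre L => ⟪A p y, y⟫_ℝ := by
    have h := Measurable.comp hAm (measurable_const.prodMk measurable_id : Measurable fun y : GnoFibre L => (p, y))
    exact h
  -- the integrand in the two spellings
  have hfun : (fun y : GnoFibre L => Real.exp (-(iteratedDeriv 2
      (fun s : ℝ => gnoDeficit (fun _ => false) (fun _ => 1) a ε (gnoBase p.1 p.2 + s • gnoFibreEmb y)) 0 / 2))) =
      fun y => Real.exp (-(⟪A p y, y⟫_ℝ / 2)) := funext fun y => by rw [hray p y]
  rw [hfun]
  obtain ⟨hint, -⟩ := gaussian_floor_of_le hQm hμ0 hΛ hlo hhi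
  exact ⟨hint, normalised_gaussian_floor_of_le hQm hμ0 hΛ hlo hhi⟩

/-! ## §2 The base density floor on the unit square -/

/-- The base density is `(1+x₀²)^{−2}(1+y₀²)^{−2}`: the `z`-letter and the followers sit at `0` where the gnomonic weight is `1`. [folklore] -/
theorem gnoDensity_gnoBase_eq (x₀ y₀ : ℝ) :
    gnoDensity (gnoBase x₀ y₀ : GnoCoord L) = ((1 + x₀ ^ 2)⁻¹) ^ 2 * ((1 + y₀ ^ 2)⁻¹) ^ 2 := by
  unfold gnoDensity gnoBase
  have h0 : gnomonicWeight (0 : Fin 3 → ℝ) = 1 := by simp [gnomonicWeight, Gnomonic.normSq3]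
  have hx : gnomonicWeight (![x₀, 0, 0] : Fin 3 → ℝ) = ((1 + x₀ ^ 2)⁻¹) ^ 2 := by
    simp [gnomonicWeight, Gnomonic.normSq3, Fin.sum_univ_three]
  have hy : gnomonicWeight (![y₀, 0, 0] : Fin 3 → ℝ) = ((1 + y₀ ^ 2)⁻¹) ^ 2 := by
    simp [gnomonicWeight, Gnomonic.normSq3, Fin.sum_univ_three]
  have hF : piWeight (0 : Fol L → Fin 3 → ℝ) = 1 := by
    unfold piWeight
    exact Finset.prod_eq_one fun i _ => by simpa using h0
  simp only [hx, hy]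
  rw [h0, hF]
  ring

/-- ★ `ρ(η₀(x₀,y₀)) ≥ 1/16` for `|x₀| ≤ 1`, `|y₀| ≤ 1`. [folklore] -/
theorem gnoDensity_gnoBase_ge {x₀ y₀ : ℝ} (hx : |x₀| ≤ 1) (hy : |y₀| ≤ 1) :
    (1 / 16 : ℝ) ≤ gnoDensity (gnoBase x₀ y₀ : GnoCoord L) := by
  rw [gnoDensity_gnoBase_eq]
  have hx2 : x₀ ^ 2 ≤ 1 := by
    have := abs_le.1 hx; nlinarith
  have hy2 : y₀ ^ 2 ≤ 1 := by
    have := abs_le.1 hy; nlinarith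
  have h1 : (1 / 2 : ℝ) ≤ (1 + x₀ ^ 2)⁻¹ := by
    rw [one_div, inv_le_inv₀ (by norm_num) (by positivity)]; linarith
  have h2 : (1 / 2 : ℝ) ≤ (1 + y₀ ^ 2)⁻¹ := by
    rw [one_div, inv_le_inv₀ (by norm_num) (by positivity)]; linarith
  have h1' : (1 / 2 : ℝ) ^ 2 ≤ ((1 + x₀ ^ 2)⁻¹) ^ 2 := pow_le_pow_left₀ (by norm_num) h1 2
  have h2' : (1 / 2 : ℝ) ^ 2 ≤ ((1 + y₀ ^ 2)⁻¹) ^ 2 := pow_le_pow_left₀ (by norm_num) h2 2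
  calc (1 / 16 : ℝ) = (1 / 2) ^ 2 * (1 / 2) ^ 2 := by norm_num
    _ ≤ ((1 + x₀ ^ 2)⁻¹) ^ 2 * ((1 + y₀ ^ 2)⁻¹) ^ 2 := mul_le_mul h1' h2' (by positivity) (by positivity)

/-! ## §3 The floor of the main term, given integrability -/

/-- Cone-almost every hub has `re a ≠ 0` and `im a ≠ 0` (the equator `{re = 0}` and the hyperplane `{imI = 0} ⊇ {im = 0}` are Lebesgue-null; `coneMeasure ≪ vol`). [folklore] -/
theorem ae_re_ne_zero_im_ne_zero_coneMeasure : ∀ᵐ a : ℍ ∂coneMeasure, a.re ≠ 0 ∧ a.im ≠ 0 := by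
  -- `coneMeasure ≪ volume`
  have hac : coneMeasure ≪ (volume : Measure ℍ) := by
    unfold coneMeasure
    exact Measure.smul_absolutelyContinuous.trans (Measure.absolutelyContinuous_of_le Measure.restrict_le_self)
  -- `{im = 0}` is contained in the real line `span {1}`, a proper submodule, hence null
  have hsub : {x : ℍ | x.im = 0} ⊆ (Submodule.span ℝ {(1 : ℍ)} : Set ℍ) := by
    intro x hx
    simp only [Set.mem_setOf_eq] at hx
    have hxI : x.imI = 0 := by simpa using congrArg (fun q : ℍ => q.imI) hx
    have hxJ : x.imJ = 0 := by simpa using congrArg (fun q : ℍ => q.imJ) hx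
    have hxK : x.imK = 0 := by simpa using congrArg (fun q : ℍ => q.imK) hx
    have hx' : x = x.re • (1 : ℍ) := by
      ext <;> simp [hxI, hxJ, hxK]
    rw [SetLike.mem_coe, hx']
    exact Submodule.smul_mem _ _ (Submodule.subset_span rfl)
  have htop : Submodule.span ℝ {(1 : ℍ)} ≠ ⊤ := by
    intro htop
    have h1 : Module.finrank ℝ (Submodule.span ℝ (↑({1} : Finset ℍ) : Set ℍ)) ≤ ({1} : Finset ℍ).card := finrank_span_le_card _
    rw [Finset.coe_singleton, Finset.card_singleton, htop, finrank_top, Quaternion.finrank_eq_four] at h1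
    omega
  have hI : (volume : Measure ℍ) {x : ℍ | x.im = 0} = 0 :=
    measure_mono_null hsub (Measure.addHaar_submodule volume _ htop)
  have hvol : ∀ᵐ a : ℍ ∂(volume : Measure ℍ), a.re ≠ 0 ∧ a.im ≠ 0 := by
    have h1 : ∀ᵐ a : ℍ ∂(volume : Measure ℍ), a.re ≠ 0 := by
      rw [ae_iff]; simpa only [ne_eq, not_not] using volume_re_eq_zero
    have h2 : ∀ᵐ a : ℍ ∂(volume : Measure ℍ), a.im ≠ 0 := by
      rw [ae_iff]; simpa only [ne_eq, not_not] using hI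
    filter_upwards [h1, h2] with a ha1 ha2
    exact ⟨ha1, ha2⟩
  exact hac.ae_le hvol

/-- ★★ **FLOOR OF THE MAIN TERM (all-plus signs), GIVEN INTEGRABILITY.**  With `𝔪(a,p) = ρ(η₀(p))·(2π)^{−α}·∫e^{−½Q_{a,p}}` for the sign pattern
`εp = ((+,+),(+,+…+))`: if `(a,p) ↦ 𝔪` is integrable on `cone × ℝ²` (stub S3) then `¼·(20400L⁴)^{−α} ≤ ∫_cone ∫_{ℝ²} 𝔪`
(§1 + §2 on the unit square of area `4` at cone-a.e. hub; Fubini). [cite: Luscher1983, §2] -/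
theorem mainTerm_floor_of_integrable
    (hint : Integrable (fun ap : ℍ × (ℝ × ℝ) =>
      gnoDensity (gnoBase ap.2.1 ap.2.2 : GnoCoord L) * ((2 * Real.pi) ^ ((Module.finrank ℝ (GnoFibre L) : ℝ) / 2))⁻¹ *
        ∫ y : GnoFibre L, Real.exp (-(iteratedDeriv 2 (fun s : ℝ => gnoDeficit (fun _ => false) (fun _ => 1) ap.1
          (((true, true), (true, fun _ => true)) : GnoSign L) (gnoBase ap.2.1 ap.2.2 + s • gnoFibreEmb y)) 0 / 2)))
      (coneMeasure.prod volume)) :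
    (1 / 4 : ℝ) * (20400 * (L : ℝ) ^ 4) ^ (-((Module.finrank ℝ (GnoFibre L) : ℝ) / 2)) ≤
      ∫ a, (∫ p : ℝ × ℝ, gnoDensity (gnoBase p.1 p.2 : GnoCoord L) * ((2 * Real.pi) ^ ((Module.finrank ℝ (GnoFibre L) : ℝ) / 2))⁻¹ *
        ∫ y : GnoFibre L, Real.exp (-(iteratedDeriv 2 (fun s : ℝ => gnoDeficit (fun _ => false) (fun _ => 1) a
          (((true, true), (true, fun _ => true)) : GnoSign L) (gnoBase p.1 p.2 + s • gnoFibreEmb y)) 0 / 2))) ∂coneMeasure := by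
  haveI := isProbabilityMeasure_coneMeasure
  set εp : GnoSign L := ((true, true), (true, fun _ => true)) with hεp
  set Λα : ℝ := (20400 * (L : ℝ) ^ 4) ^ (-((Module.finrank ℝ (GnoFibre L) : ℝ) / 2)) with hΛα
  set D : ℍ → ℝ × ℝ → ℝ := fun a p => gnoDensity (gnoBase p.1 p.2 : GnoCoord L) * ((2 * Real.pi) ^ ((Module.finrank ℝ (GnoFibre L) : ℝ) / 2))⁻¹ *
    ∫ y : GnoFibre L, Real.exp (-(iteratedDeriv 2 (fun s : ℝ => gnoDeficit (fun _ => false) (fun _ => 1) a εp (gnoBase p.1 p.2 + s • gnoFibreEmb y)) 0 / 2)) with hD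
  have hL0 : (0 : ℝ) < L := by exact_mod_cast NeZero.pos L
  have hΛα0 : 0 < Λα := Real.rpow_pos_of_pos (by positivity) _
  -- pointwise: `D ≥ 0` everywhere, `D ≥ Λα/16` on the unit square at a good hub
  have hD0 : ∀ a p, 0 ≤ D a p := fun a p => by
    simp only [hD]
    exact mul_nonneg (mul_nonneg (gnoDensity_pos _).le (by positivity)) (integral_nonneg fun y => (Real.exp_pos _).le)
  have hDfloor : ∀ a : ℍ, a.re ≠ 0 → a.im ≠ 0 → ∀ p : ℝ × ℝ, |p.1| ≤ 1 → |p.2| ≤ 1 → Λα / 16 ≤ D a p := by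
    intro a hre him p hp1 hp2
    obtain ⟨-, hfl⟩ := fibreFactor_floor (L := L) hre him εp rfl rfl p
    have hρ := gnoDensity_gnoBase_ge (L := L) hp1 hp2
    simp only [hD]
    rw [mul_assoc]
    calc Λα / 16 = (1 / 16) * Λα := by ring
      _ ≤ gnoDensity (gnoBase p.1 p.2 : GnoCoord L) * (((2 * Real.pi) ^ ((Module.finrank ℝ (GnoFibre L) : ℝ) / 2))⁻¹ *
          ∫ y : GnoFibre L, Real.exp (-(iteratedDeriv 2 (fun s : ℝ => gnoDeficit (fun _ => false) (fun _ => 1) a εp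
            (gnoBase p.1 p.2 + s • gnoFibreEmb y)) 0 / 2))) := mul_le_mul hρ hfl hΛα0.le (gnoDensity_pos _).le
  -- Fubini data
  have hint' : Integrable (fun ap : ℍ × (ℝ × ℝ) => D ap.1 ap.2) (coneMeasure.prod volume) := hint
  have hfib : ∀ᵐ a ∂coneMeasure, Integrable (fun p : ℝ × ℝ => D a p) volume := hint'.prod_right_ae
  have hout : Integrable (fun a => ∫ p, D a p) coneMeasure := hint'.integral_prod_left
  -- the square and its area
  set B : Set (ℝ × ℝ) := Icc (-1 : ℝ) 1 ×ˢ Icc (-1 : ℝ) 1 with hB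
  have hBm : MeasurableSet B := measurableSet_Icc.prod measurableSet_Icc
  have hBvol : (volume : Measure (ℝ × ℝ)) B = ENNReal.ofReal 4 := by
    rw [hB, Measure.volume_eq_prod, Measure.prod_prod, Real.volume_Icc, ← ENNReal.ofReal_mul (by norm_num)]
    norm_num
  -- inner floor at a good hub
  have hinner : ∀ᵐ a ∂coneMeasure, 4 * (Λα / 16) ≤ ∫ p, D a p := by
    filter_upwards [ae_re_ne_zero_im_ne_zero_coneMeasure, hfib] with a ha hfa
    have hind : ∫ p, B.indicator (fun _ => Λα / 16) p = 4 * (Λα / 16) := by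
      rw [integral_indicator_const _ hBm, smul_eq_mul, measureReal_def, hBvol, ENNReal.toReal_ofReal (by norm_num)]
    rw [← hind]
    refine integral_mono_of_nonneg (Filter.Eventually.of_forall fun p => ?_) hfa (Filter.Eventually.of_forall fun p => ?_)
    · simp only [Pi.zero_apply]
      by_cases hp : p ∈ B
      · rw [indicator_of_mem hp]; exact (div_pos hΛα0 (by norm_num)).le
      · rw [indicator_of_notMem hp]
    · by_cases hp : p ∈ B
      · rw [indicator_of_mem hp]
        have hp' : p.1 ∈ Icc (-1 : ℝ) 1 ∧ p.2 ∈ Icc (-1 : ℝ) 1 := by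
          rw [hB] at hp; exact ⟨hp.1, hp.2⟩
        exact hDfloor a ha.1 ha.2 p (abs_le.2 ⟨hp'.1.1, hp'.1.2⟩) (abs_le.2 ⟨hp'.2.1, hp'.2.2⟩)
      · rw [indicator_of_notMem hp]; exact hD0 a p
  -- outer integral
  have hconst : ∫ _ : ℍ, 4 * (Λα / 16) ∂coneMeasure = (1 / 4 : ℝ) * Λα := by
    rw [integral_const, smul_eq_mul, measureReal_def, measure_univ, ENNReal.toReal_one]; ring
  rw [← hconst]
  exact integral_mono_of_nonneg (Filter.Eventually.of_forall fun a => by positivity) hout hinner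

/-- ★★ **FLOOR OF THE MAIN CONSTANT, GIVEN INTEGRABILITY**: for any finite set `S` of sign patterns containing the all-plus pattern and any prefactor `K ≥ 0`,
`K·¼·(20400L⁴)^{−α} ≤ K·Σ_{ε ∈ S}∫_cone∫_{ℝ²}𝔪_ε` (the other patterns contribute `≥ 0`).  With `S` = the good patterns and `K = K_L` this is the skeleton's
`stub_mbConst_floor` up to the logarithmic arithmetic `log(K_L·¼·(20400L⁴)^{−(9L⁴−1)}) ≥ −K·L⁵`. [cite: Luscher1983, §2] -/
theorem mainConst_floor_of_integrable {K : ℝ} (hK : 0 ≤ K) (S : Finset (GnoSign L))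
    (hS : (((true, true), (true, fun _ => true)) : GnoSign L) ∈ S)
    (hint : Integrable (fun ap : ℍ × (ℝ × ℝ) =>
      gnoDensity (gnoBase ap.2.1 ap.2.2 : GnoCoord L) * ((2 * Real.pi) ^ ((Module.finrank ℝ (GnoFibre L) : ℝ) / 2))⁻¹ *
        ∫ y : GnoFibre L, Real.exp (-(iteratedDeriv 2 (fun s : ℝ => gnoDeficit (fun _ => false) (fun _ => 1) ap.1
          (((true, true), (true, fun _ => true)) : GnoSign L) (gnoBase ap.2.1 ap.2.2 + s • gnoFibreEmb y)) 0 / 2)))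
      (coneMeasure.prod volume)) :
    K * ((1 / 4 : ℝ) * (20400 * (L : ℝ) ^ 4) ^ (-((Module.finrank ℝ (GnoFibre L) : ℝ) / 2))) ≤
      K * ∑ ε ∈ S, ∫ a, (∫ p : ℝ × ℝ, gnoDensity (gnoBase p.1 p.2 : GnoCoord L) * ((2 * Real.pi) ^ ((Module.finrank ℝ (GnoFibre L) : ℝ) / 2))⁻¹ *
        ∫ y : GnoFibre L, Real.exp (-(iteratedDeriv 2 (fun s : ℝ => gnoDeficit (fun _ => false) (fun _ => 1) a ε
          (gnoBase p.1 p.2 + s • gnoFibreEmb y)) 0 / 2))) ∂coneMeasure := by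
  refine mul_le_mul_of_nonneg_left ?_ hK
  have hterm := mainTerm_floor_of_integrable (L := L) hint
  refine hterm.trans ?_
  refine Finset.single_le_sum (f := fun ε : GnoSign L => ∫ a, (∫ p : ℝ × ℝ, gnoDensity (gnoBase p.1 p.2 : GnoCoord L) *
      ((2 * Real.pi) ^ ((Module.finrank ℝ (GnoFibre L) : ℝ) / 2))⁻¹ *
        ∫ y : GnoFibre L, Real.exp (-(iteratedDeriv 2 (fun s : ℝ => gnoDeficit (fun _ => false) (fun _ => 1) a ε
          (gnoBase p.1 p.2 + s • gnoFibreEmb y)) 0 / 2))) ∂coneMeasure) (fun ε _ => ?_) hS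
  exact integral_nonneg fun a => integral_nonneg fun p =>
    mul_nonneg (mul_nonneg (gnoDensity_pos _).le (by positivity)) (integral_nonneg fun y => (Real.exp_pos _).le)

end Summit.QuantumFields.YangMills.Theorems.SwapVirialDeficit.BlowUpRing

end
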